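import Literature.MathematicalPhysics.QuantumFieldTheory.LatticeGaugeDobrushinPoincare
import HarnessLib

/-!
# Robust ball (Y2) — the AXIS OFFSET MULTISET of the `ℤ^d` link graph and the half-line supersolution inequality

HONEST FRAMING: venture file of the cell `pub-ymgap` (QuantumFields programme), track ROBUST-BALL, seat rb-p2 (g10).  Pure lattice
combinatorics on `ℤ^d` (no measure theory): for a link `e = (x, μ)` and an axis `i`, put `H_i(y) = 2 y_i + [dir y = i]` (twice the
`i`-coordinate of the midpoint of the link `y`) and the OFFSET `D_i(e, y) = H_i(y) − H_i(e)`.  Over the staple links of the `≤ 2(d−1)`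
plaquettes through `e` (the support of Dobrushin's influence count `linkInfluence e ·` of the Wilson one-link law,
`LatticeGaugeDobrushinPoincare`) the offsets form the multiset `{+1, 0, −1}` per plaquette when `μ = i`, and `{+2, +1, +1}`, `{−2, −1, −1}`
for the two plaquettes in the plane `(μ, i)` plus `{0,0,0}` for the `2(d−2)` others when `μ ≠ i`.  Consequently, for every weight
`c : ℤ → ℝ≥0`: `∑_{p ∋ e} ∑_k c(D_i(e, staple_k)) ≤ P_c(e)` with `P_c = 2(d−1)(c(1) + c(0) + c(−1))` (`μ = i`) resp.
`c(2) + 2c(1) + 2c(−1) + c(−2) + 6(d−2)c(0)` (`μ ≠ i`) (`sum_weight_stapleLinks_le`), and for every `u ≥ 0` on links with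
`u(y) ≤ c(D_i(e,y)) u(e)`: `∑_{y ∈ T} linkInfluence e y · u(y) ≤ P_c(e) · u(e)` (`sum_linkInfluence_mul_le_axis`).  With `c(δ) = φ^{−δ}` these are
the two polynomials `2(d−1)(φ⁻¹ + 1 + φ)` and `φ⁻² + 2φ⁻¹ + 2φ + φ² + 6(d−2)` of the axis supersolution for the `ℤ^d` mass-gap rate
(sibling `ZdAxisClustering`).  Nothing about the continuum or Clay.
-/

noncomputable section

open Finset Function
open Literature.MathematicalPhysics.QuantumLattice
open Literature.MathematicalPhysics.QuantumFieldTheory hiding ZdEdge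

namespace Summit.Ventures.YMGap.RobustBall.ZdAxis

variable {d : ℕ}

/-! ### The doubled axis coordinate and the offset -/

/-- The four links of the plaquette `p = (z, j < k)` and their doubled `i`-coordinates relative to `2 z_i`:
`(z, j) ↦ [j = i]`, `(z + e_j, k) ↦ 2[j = i] + [k = i]`, `(z + e_k, j) ↦ 2[k = i] + [j = i]`, `(z, k) ↦ [k = i]`. [folklore] -/
theorem two_mul_sub_add_plaqLinks (p : ZdPlaquette d) (i : Fin d) :
    (2 * ((plaqLink1 p).1 i - p.1 i) + (if (plaqLink1 p).2 = i then 1 else 0) : ℤ) = (if p.2.1.1 = i then 1 else 0) ∧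
    (2 * ((plaqLink2 p).1 i - p.1 i) + (if (plaqLink2 p).2 = i then 1 else 0) : ℤ) =
        2 * (if p.2.1.1 = i then 1 else 0) + (if p.2.1.2 = i then 1 else 0) ∧
    (2 * ((plaqLink3 p).1 i - p.1 i) + (if (plaqLink3 p).2 = i then 1 else 0) : ℤ) =
        2 * (if p.2.1.2 = i then 1 else 0) + (if p.2.1.1 = i then 1 else 0) ∧
    (2 * ((plaqLink4 p).1 i - p.1 i) + (if (plaqLink4 p).2 = i then 1 else 0) : ℤ) = (if p.2.1.2 = i then 1 else 0) := by
  refine ⟨by simp [plaqLink1], ?_, ?_, by simp [plaqLink4]⟩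
  · simp only [plaqLink2, Pi.add_apply, add_sub_cancel_left]
    by_cases h : p.2.1.1 = i
    · subst h; simp
    · rw [Pi.single_eq_of_ne' h]; simp [h]
  · simp only [plaqLink3, Pi.add_apply, add_sub_cancel_left]
    by_cases h : p.2.1.2 = i
    · subst h; simp
    · rw [Pi.single_eq_of_ne' h]; simp [h]

/-- The sum of a function over the three staple links of `p` at a link `e ∈ p` is the sum over the four links minus the value
at `e`. [folklore] -/
theorem sum_stapleLinks_eq [DecidableEq (ZdEdge d)] (p : ZdPlaquette d) {e : ZdEdge d} (he : e ∈ plaquetteEdges p)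
    (f : ZdEdge d → ℝ) :
    ∑ k : Fin 3, f (stapleLinks p e k) =
      f (plaqLink1 p) + f (plaqLink2 p) + f (plaqLink3 p) + f (plaqLink4 p) - f e := by
  have h12 := plaqLink1_ne_plaqLink2 p
  have h13 := plaqLink1_ne_plaqLink3 p
  have h14 := plaqLink1_ne_plaqLink4 p
  have h23 := plaqLink2_ne_plaqLink3 p
  have h24 := plaqLink2_ne_plaqLink4 p
  have h34 := plaqLink3_ne_plaqLink4 p
  rw [plaquetteEdges_eq] at he
  simp only [Finset.mem_insert, Finset.mem_singleton] at he
  rcases he with rfl | rfl | rfl | rfl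
  · simp [stapleLinks, Fin.sum_univ_three]; ring
  · simp [stapleLinks, h12.symm, Fin.sum_univ_three]; ring
  · simp [stapleLinks, h13.symm, h23.symm, Fin.sum_univ_three]; ring
  · simp [stapleLinks, h14.symm, h24.symm, h34.symm, Fin.sum_univ_three]; ring

/-! ### The per-plaquette offset sums -/

/-- The weight polynomial of the other direction `ν` and the side `b` of a plaquette through `e = (x, μ)`, axis `i`:
`c(1) + c(0) + c(−1)` if `μ = i`; `c(2) + 2c(1)` / `c(−2) + 2c(−1)` for the two sides of the plane `(μ, i)`; `3c(0)` otherwise.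
(Written inline; this lemma evaluates the per-plaquette sum.) [folklore] -/
theorem sum_weight_stapleLinks_eq [DecidableEq (ZdEdge d)] (c : ℤ → ℝ) (p : ZdPlaquette d) {e : ZdEdge d}
    (he : e ∈ plaquetteEdges p) (i : Fin d) :
    ∑ k : Fin 3, c (2 * ((stapleLinks p e k).1 i - e.1 i) + (if (stapleLinks p e k).2 = i then 1 else 0) -
        (if e.2 = i then 1 else 0)) =
      if e.2 = i then c 1 + c 0 + c (-1)
      else if plaqOtherDir e p = i then (if plaqSide e p then c 2 + 2 * c 1 else c (-2) + 2 * c (-1))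
      else 3 * c 0 := by
  obtain ⟨h1, h2, h3, h4⟩ := two_mul_sub_add_plaqLinks p i
  have hjk : p.2.1.1 ≠ p.2.1.2 := (p.2.2).ne
  have hsum := sum_stapleLinks_eq p he (fun y => c (2 * (y.1 i - e.1 i) + (if y.2 = i then 1 else 0) -
    (if e.2 = i then 1 else 0)))
  rw [hsum]
  -- express all offsets relative to the base point `p.1`
  have hrel : ∀ y : ZdEdge d, (2 * (y.1 i - e.1 i) + (if y.2 = i then 1 else 0) - (if e.2 = i then 1 else 0) : ℤ) =
      (2 * (y.1 i - p.1 i) + (if y.2 = i then 1 else 0)) - (2 * (e.1 i - p.1 i) + (if e.2 = i then 1 else 0)) := by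
    intro y; ring
  simp only [hrel, h1, h2, h3, h4]
  rw [plaquetteEdges_eq] at he
  simp only [Finset.mem_insert, Finset.mem_singleton] at he
  rcases he with rfl | rfl | rfl | rfl
  · -- `e = (z, j)`: `μ = j`, other direction `k`, side `+`
    rw [h1]
    have hod : plaqOtherDir (plaqLink1 p) p = p.2.1.2 := by simp [plaqOtherDir, plaqLink1]
    have hsd : plaqSide (plaqLink1 p) p = true := by simp [plaqSide, plaqLink1]
    rw [hod, hsd]
    simp only [plaqLink1, if_true]
    by_cases hj : p.2.1.1 = i
    · have hk : p.2.1.2 ≠ i := fun h => hjk (hj.trans h.symm)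
      simp [hj, hk]; ring
    · by_cases hk : p.2.1.2 = i
      · simp [hj, hk]; ring
      · simp [hj, hk]; ring
  · -- `e = (z + e_j, k)`: `μ = k`, other direction `j`, side `−`
    rw [h2]
    have hod : plaqOtherDir (plaqLink2 p) p = p.2.1.1 := by simp [plaqOtherDir, plaqLink2, hjk]
    have hsd : plaqSide (plaqLink2 p) p = false := by
      simp [plaqSide, plaqLink2]
    rw [hod, hsd]
    simp only [plaqLink2]
    by_cases hk : p.2.1.2 = i
    · have hj : p.2.1.1 ≠ i := fun h => hjk (h.trans hk.symm)
      simp [hj, hk]; ring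
    · by_cases hj : p.2.1.1 = i
      · simp [hj, hk]; ring
      · simp [hj, hk]; ring
  · -- `e = (z + e_k, j)`: `μ = j`, other direction `k`, side `−`
    rw [h3]
    have hod : plaqOtherDir (plaqLink3 p) p = p.2.1.2 := by simp [plaqOtherDir, plaqLink3]
    have hsd : plaqSide (plaqLink3 p) p = false := by
      simp [plaqSide, plaqLink3]
    rw [hod, hsd]
    simp only [plaqLink3]
    by_cases hj : p.2.1.1 = i
    · have hk : p.2.1.2 ≠ i := fun h => hjk (hj.trans h.symm)
      simp [hj, hk]; ring
    · by_cases hk : p.2.1.2 = i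
      · simp [hj, hk]; ring
      · simp [hj, hk]; ring
  · -- `e = (z, k)`: `μ = k`, other direction `j`, side `+`
    rw [h4]
    have hod : plaqOtherDir (plaqLink4 p) p = p.2.1.1 := by simp [plaqOtherDir, plaqLink4, hjk]
    have hsd : plaqSide (plaqLink4 p) p = true := by simp [plaqSide, plaqLink4]
    rw [hod, hsd]
    simp only [plaqLink4, if_true]
    by_cases hk : p.2.1.2 = i
    · have hj : p.2.1.1 ≠ i := fun h => hjk (h.trans hk.symm)
      simp [hj, hk]; ring
    · by_cases hj : p.2.1.1 = i
      · simp [hj, hk]; ring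
      · simp [hj, hk]; ring


/-! ### Summing over the plaquettes through `e` -/

/-- **THE AXIS OFFSET MULTISET BOUND.**  For `d ≥ 2`, a link `e = (x, μ)`, an axis `i` and a weight `c : ℤ → ℝ≥0`:
`∑_{p ∋ e} ∑_k c(D_i(e, staple_k(p))) ≤ 2(d−1)(c(1) + c(0) + c(−1))` if `μ = i`, and
`≤ c(2) + 2c(1) + 2c(−1) + c(−2) + 6(d−2)c(0)` if `μ ≠ i` (equality when all `2(d−1)` plaquettes are counted; the tree only records
`#{p ∋ e} ≤ 2(d−1)` through the injection `p ↦ (other direction, side)`, so we state `≤`). [folklore] -/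
theorem sum_weight_plaquettesTouching_le [DecidableEq (ZdEdge d)] (hd : 2 ≤ d) (c : ℤ → ℝ) (hc : ∀ z, 0 ≤ c z)
    (e : ZdEdge d) (i : Fin d) :
    ∑ p ∈ plaquettesTouching {e}, ∑ k : Fin 3,
        c (2 * ((stapleLinks p e k).1 i - e.1 i) + (if (stapleLinks p e k).2 = i then 1 else 0) - (if e.2 = i then 1 else 0)) ≤
      if e.2 = i then 2 * ((d - 1 : ℕ) : ℝ) * (c 1 + c 0 + c (-1))
      else c 2 + 2 * c 1 + 2 * c (-1) + c (-2) + 6 * ((d - 2 : ℕ) : ℝ) * c 0 := by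
  classical
  -- the per-plaquette value as a function of (other direction, side)
  set T' : Fin d × Bool → ℝ := fun q =>
    if e.2 = i then c 1 + c 0 + c (-1)
    else if q.1 = i then (if q.2 then c 2 + 2 * c 1 else c (-2) + 2 * c (-1)) else 3 * c 0 with hT'
  have hT'0 : ∀ q, 0 ≤ T' q := by
    intro q; simp only [hT']
    have := hc 1; have := hc 0; have := hc (-1); have := hc 2; have := hc (-2)
    split_ifs <;> linarith
  set g : ZdPlaquette d → Fin d × Bool := fun p => (plaqOtherDir e p, plaqSide e p) with hg
  have hterm : ∀ p ∈ plaquettesTouching {e}, ∑ k : Fin 3,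
      c (2 * ((stapleLinks p e k).1 i - e.1 i) + (if (stapleLinks p e k).2 = i then 1 else 0) -
        (if e.2 = i then 1 else 0)) = T' (g p) := by
    intro p hp
    rw [sum_weight_stapleLinks_eq c p (mem_plaquettesTouching_singleton.1 hp) i]
  rw [Finset.sum_congr rfl hterm]
  -- injectivity of `p ↦ (other direction, side)` on the plaquettes through `e`
  have hinj : Set.InjOn g ↑(plaquettesTouching {e}) := by
    intro p hp p' hp' h
    have h1 := plaqRecover_eq (mem_plaquettesTouching_singleton.1 (Finset.mem_coe.1 hp))
    have h2 := plaqRecover_eq (mem_plaquettesTouching_singleton.1 (Finset.mem_coe.1 hp'))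
    have h12 : (p.1, p.2.1) = (p'.1, p'.2.1) := by
      rw [← h1, ← h2]; exact congrArg (plaqRecover e) h
    obtain ⟨hfst, hsnd⟩ := Prod.mk.inj h12
    exact Prod.ext hfst (Subtype.ext hsnd)
  have hmaps : (plaquettesTouching {e}).image g ⊆ (Finset.univ.erase e.2) ×ˢ (Finset.univ : Finset Bool) := by
    intro q hq
    obtain ⟨p, _, rfl⟩ := Finset.mem_image.1 hq
    exact Finset.mem_product.2 ⟨Finset.mem_erase.2 ⟨plaqOtherDir_ne e p, Finset.mem_univ _⟩, Finset.mem_univ _⟩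
  calc ∑ p ∈ plaquettesTouching {e}, T' (g p)
      = ∑ q ∈ (plaquettesTouching {e}).image g, T' q := (Finset.sum_image hinj).symm
    _ ≤ ∑ q ∈ (Finset.univ.erase e.2) ×ˢ (Finset.univ : Finset Bool), T' q :=
        Finset.sum_le_sum_of_subset_of_nonneg hmaps fun q _ _ => hT'0 q
    _ = _ := by
        by_cases hμ : e.2 = i
        · simp only [hT', hμ, if_true, Finset.sum_const, Finset.card_product, Finset.card_erase_of_mem (Finset.mem_univ _),
            Finset.card_univ, Fintype.card_fin, Fintype.card_bool, nsmul_eq_mul]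
          push_cast [Nat.cast_sub (by omega : 1 ≤ d)]
          ring
        · rw [Finset.sum_product]
          have hi : i ∈ Finset.univ.erase e.2 := Finset.mem_erase.2 ⟨Ne.symm hμ, Finset.mem_univ _⟩
          rw [← Finset.add_sum_erase _ _ hi]
          have hfirst : ∑ b : Bool, T' (i, b) = c 2 + 2 * c 1 + (c (-2) + 2 * c (-1)) := by
            simp [hT', hμ]
          have hrest : ∀ ν ∈ (Finset.univ.erase e.2).erase i, ∑ b : Bool, T' (ν, b) = 6 * c 0 := by
            intro ν hν
            have hνi : ν ≠ i := (Finset.mem_erase.1 hν).1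
            simp [hT', hμ, hνi]; ring
          have hcard : ((Finset.univ.erase e.2).erase i).card = d - 2 := by
            rw [Finset.card_erase_of_mem hi, Finset.card_erase_of_mem (Finset.mem_univ _), Finset.card_univ, Fintype.card_fin]
            omega
          rw [hfirst, Finset.sum_congr rfl hrest, Finset.sum_const, nsmul_eq_mul, hcard, if_neg hμ]
          ring

/-- **THE HALF-LINE SUPERSOLUTION INEQUALITY ON `ℤ^d` (Wilson part).**  If `u ≥ 0` on links satisfies the RATIO BOUND
`u(y) ≤ c(D_i(e,y)) · u(e)` for all `y` (e.g. `u = φ^{(a − H_i)_+}` with `c(δ) = φ^{−δ}`), then for every finite link set `T`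
`∑_{y ∈ T} linkInfluence e y · u(y) ≤ P_c(e) · u(e)` with the two polynomials of `sum_weight_plaquettesTouching_le`. [folklore] -/
theorem sum_linkInfluence_mul_le_axis [DecidableEq (ZdEdge d)] (hd : 2 ≤ d) (c : ℤ → ℝ) (hc : ∀ z, 0 ≤ c z)
    (e : ZdEdge d) (i : Fin d) {u : ZdEdge d → ℝ} (hu0 : ∀ y, 0 ≤ u y)
    (hu : ∀ y, u y ≤ c (2 * (y.1 i - e.1 i) + (if y.2 = i then 1 else 0) - (if e.2 = i then 1 else 0)) * u e)
    (T : Finset (ZdEdge d)) :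
    ∑ y ∈ T, (linkInfluence e y : ℝ) * u y ≤
      (if e.2 = i then 2 * ((d - 1 : ℕ) : ℝ) * (c 1 + c 0 + c (-1))
        else c 2 + 2 * c 1 + 2 * c (-1) + c (-2) + 6 * ((d - 2 : ℕ) : ℝ) * c 0) * u e := by
  classical
  have hue : 0 ≤ u e := hu0 e
  -- `∑_T n(e,y) u(y) ≤ ∑_{p ∋ e} ∑_k u(staple_k)`
  have h1 : ∑ y ∈ T, (linkInfluence e y : ℝ) * u y ≤ ∑ p ∈ plaquettesTouching {e}, ∑ k : Fin 3, u (stapleLinks p e k) := by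
    unfold linkInfluence
    push_cast
    simp only [Finset.sum_mul]
    rw [Finset.sum_comm]
    refine Finset.sum_le_sum fun p _ => ?_
    rw [Finset.sum_comm]
    refine Finset.sum_le_sum fun k _ => ?_
    rw [show ∑ y ∈ T, (if stapleLinks p e k = y then (1 : ℝ) else 0) * u y =
      ∑ y ∈ T, (if stapleLinks p e k = y then u y else 0) from Finset.sum_congr rfl fun y _ => by split_ifs <;> simp,
      Finset.sum_ite_eq]
    split_ifs
    · exact le_rfl
    · exact hu0 _
  refine h1.trans ?_
  calc ∑ p ∈ plaquettesTouching {e}, ∑ k : Fin 3, u (stapleLinks p e k)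
      ≤ ∑ p ∈ plaquettesTouching {e}, ∑ k : Fin 3,
          c (2 * ((stapleLinks p e k).1 i - e.1 i) + (if (stapleLinks p e k).2 = i then 1 else 0) -
            (if e.2 = i then 1 else 0)) * u e :=
        Finset.sum_le_sum fun p _ => Finset.sum_le_sum fun k _ => hu _
    _ = (∑ p ∈ plaquettesTouching {e}, ∑ k : Fin 3,
          c (2 * ((stapleLinks p e k).1 i - e.1 i) + (if (stapleLinks p e k).2 = i then 1 else 0) -
            (if e.2 = i then 1 else 0))) * u e := by
        rw [Finset.sum_mul]; exact Finset.sum_congr rfl fun p _ => (Finset.sum_mul _ _ _).symm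
    _ ≤ _ := mul_le_mul_of_nonneg_right (sum_weight_plaquettesTouching_le hd c hc e i) hue

end Summit.Ventures.YMGap.RobustBall.ZdAxis

end
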